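import Summits.QuantumFields.YangMills.Theorems.BalabanLadderInfVolFloors
import Summits.QuantumFields.YangMills.Theorems.InfiniteVolumeUniformBound
import Summits.QuantumFields.YangMills.Theorems.LangevinControlUVOSLegsFromFemtoAndGapStubAssemblyPlaneExpansion
import HarnessLib

/-!
# The density ↔ plane-string dictionary for the infinite-volume correlation data

HONEST FRAMING (R136 (i) «parallel continuum programme», seat `ym-infvol-p1`, pre-birth helper; bears on the spine route
`BalabanLadder`, leaf `UV` = stmt-QuantumFields-19351; junction between the NT-leg floors and the E0′-leg plane-string
functionals of the infinite-volume route).  Pure algebra / bookkeeping over the NAMED infinite-volume data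
(`stateMomentStr` of `…InfVolCeilingsDefs`, `stateCov`, `stateK3`, `Q2State`, `Q3State` of `…InfVolFloorsDefs`); nothing
about Yang–Mills is asserted.  Existence half only; not a gap, not Clay.

WHY.  The non-triviality floors (`LowerBoundsTL`: `ε ≤ Q2State μ (aβ) θv v`, `ε ≤ |Q3State μ (aβ) f g h|`) are stated for
the ACTION DENSITY `Aₓ = Σ_{q valid} P^q_x` (tree `dens_eq_sum_filter_plane`), while the continuum data of the
infinite-volume route are extracted from the PLANE-STRING series `Σ'ₓ stateMomentStr μ n q x · F(a x)` (seats p2/p3).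
This file is the dictionary: the centred density moments of a probability state are the orientation sums of the
plane-string weights, so `Q2State` / `Q3State` are finite orientation sums of `n = 2` / `n = 3` plane-string series with
tensor weights — the non-triviality floors therefore bear on the same series the E0′ bounds, E2 and the translations speak
about.

* §1 `integral_centred_two`, `integral_centred_three` — centred product integrals of bounded observables in a
  probability state; `stateCov_eq_integral_centred`, `stateK3_eq_integral_centred` (the covariance / third cumulant ARE
  the second / third centred mixed moments of the densities).
* §2 **`integral_prod_dens_centred_eq_sum_stateMomentStr`** — for every `n` and sites `x`:
  `∫ ∏ᵢ (A_{xᵢ} − ∫ A_{xᵢ} dμ) dμ = Σ_{Q : Fin n → valid} stateMomentStr μ n Q x` (multilinear expansion,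
  `Finset.prod_univ_sum`).
* §3 `stateCov_eq_sum_stateMomentStr`, `stateK3_eq_sum_stateMomentStr` (`n = 2, 3`).
* §4 **`q2State_eq_sum_series`**, **`q3State_eq_sum_series`** — `Q2State μ s f g = Σ_{Q} Σ'_{(x,y)} f(s x) g(s y) ·
  stateMomentStr μ 2 Q ![x, y]` and the `n = 3` analogue (`s > 0`, probability `μ`; the series converge absolutely by the
  sup bound `(2Cₚ)ⁿ` of seat p2's `abs_infVolWeight_le` and `summable_abs_pairWeight` / `…tripleWeight`).

References: K. Osterwalder, E. Seiler, Ann. Phys. 110 (1978) §2; E. Seiler, LNP 159 (1982) Ch. 2.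
-/

set_option autoImplicit false

noncomputable section

open MeasureTheory Filter Topology
open scoped BigOperators SchwartzMap
open Literature.MathematicalPhysics.QuantumFieldTheory hiding ZdEdge
open Literature.MathematicalPhysics.QuantumLattice
open Literature.Probability.LatticeModels (Site)
open Summit.QuantumFields.YangMills.Cruxes.OSLegsFromFemtoAndGap.DlrCollarTransfer
open Summit.QuantumFields.YangMills.Theorems.OSLegsFromFemtoAndGap (dens_eq_sum_filter_plane)

namespace Summit.QuantumFields.YangMills.Theorems.InfiniteVolume

/-! ## §1 Centred product integrals; covariance and third cumulant as centred moments -/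

section Centred

variable {X : Type*} [MeasurableSpace X] (μ : Measure X) [IsProbabilityMeasure μ]

/-- `∫ (A − a)(B − b) dμ = ∫ AB dμ − a ∫ B dμ − b ∫ A dμ + a b` for bounded measurable `A, B` in a probability state.
[folklore] -/
theorem integral_centred_two {A B : X → ℝ} (hA : Measurable A) (hB : Measurable B) {CA CB : ℝ}
    (hAb : ∀ x, |A x| ≤ CA) (hBb : ∀ x, |B x| ≤ CB) (a b : ℝ) :
    ∫ x, (A x - a) * (B x - b) ∂μ = (∫ x, A x * B x ∂μ) - a * (∫ x, B x ∂μ) - b * (∫ x, A x ∂μ) + a * b := by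
  have iA : Integrable A μ := integrable_of_abs_le hA hAb
  have iB : Integrable B μ := integrable_of_abs_le hB hBb
  have iAB : Integrable (fun x => A x * B x) μ :=
    integrable_of_abs_le (hA.mul hB) (C := CA * CB) fun x => by
      rw [abs_mul]; exact mul_le_mul (hAb x) (hBb x) (abs_nonneg _) ((abs_nonneg _).trans (hAb x))
  have iT2 : Integrable (fun x => a * B x) μ := iB.const_mul a
  have iT3 : Integrable (fun x => b * A x) μ := iA.const_mul b
  have i1 : Integrable (fun x => A x * B x - a * B x) μ := iAB.sub iT2
  have i2 : Integrable (fun x => b * A x - a * b) μ := iT3.sub (integrable_const _)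
  have e : ∀ x, (A x - a) * (B x - b) = (A x * B x - a * B x) - (b * A x - a * b) := fun x => by ring
  simp_rw [e]
  rw [integral_sub i1 i2, integral_sub iAB iT2, integral_sub iT3 (integrable_const _), integral_const_mul,
    integral_const_mul, integral_const]
  simp only [probReal_univ, smul_eq_mul, one_mul]
  ring

/-- `∫ (A − a)(B − b)(C − c) dμ` expanded, for bounded measurable `A, B, C` in a probability state. [folklore] -/
theorem integral_centred_three {A B C : X → ℝ} (hA : Measurable A) (hB : Measurable B) (hC : Measurable C)
    {M : ℝ} (hAb : ∀ x, |A x| ≤ M) (hBb : ∀ x, |B x| ≤ M) (hCb : ∀ x, |C x| ≤ M) (a b c : ℝ) :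
    ∫ x, (A x - a) * (B x - b) * (C x - c) ∂μ =
      (∫ x, A x * B x * C x ∂μ) - a * (∫ x, B x * C x ∂μ) - b * (∫ x, A x * C x ∂μ) - c * (∫ x, A x * B x ∂μ)
        + a * b * (∫ x, C x ∂μ) + a * c * (∫ x, B x ∂μ) + b * c * (∫ x, A x ∂μ) - a * b * c := by
  have i1 : ∀ {F : X → ℝ}, Measurable F → (∀ x, |F x| ≤ M) → Integrable F μ := fun hF hFb =>
    integrable_of_abs_le hF hFb
  have i2 : ∀ {F F' : X → ℝ}, Measurable F → Measurable F' → (∀ x, |F x| ≤ M) → (∀ x, |F' x| ≤ M) →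
      Integrable (fun x => F x * F' x) μ := fun hF hF' hFb hF'b =>
    integrable_of_abs_le (hF.mul hF') (C := M * M) fun x => by
      rw [abs_mul]; exact mul_le_mul (hFb x) (hF'b x) (abs_nonneg _) ((abs_nonneg _).trans (hFb x))
  have iT1 : Integrable (fun x => A x * B x * C x) μ :=
    integrable_of_abs_le ((hA.mul hB).mul hC) (C := M * M * M) fun x => by
      have hM : 0 ≤ M := (abs_nonneg _).trans (hAb x)
      rw [abs_mul, abs_mul]
      exact mul_le_mul (mul_le_mul (hAb x) (hBb x) (abs_nonneg _) hM) (hCb x) (abs_nonneg _) (mul_nonneg hM hM)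
  have iT2 : Integrable (fun x => a * (B x * C x)) μ := (i2 hB hC hBb hCb).const_mul a
  have iT3 : Integrable (fun x => b * (A x * C x)) μ := (i2 hA hC hAb hCb).const_mul b
  have iT4 : Integrable (fun x => c * (A x * B x)) μ := (i2 hA hB hAb hBb).const_mul c
  have iT5 : Integrable (fun x => a * b * C x) μ := (i1 hC hCb).const_mul _
  have iT6 : Integrable (fun x => a * c * B x) μ := (i1 hB hBb).const_mul _
  have iT7 : Integrable (fun x => b * c * A x) μ := (i1 hA hAb).const_mul _
  have i12 : Integrable (fun x => A x * B x * C x - a * (B x * C x)) μ := iT1.sub iT2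
  have i34 : Integrable (fun x => b * (A x * C x) + c * (A x * B x)) μ := iT3.add iT4
  have iL : Integrable (fun x => (A x * B x * C x - a * (B x * C x)) - (b * (A x * C x) + c * (A x * B x))) μ :=
    i12.sub i34
  have i56 : Integrable (fun x => a * b * C x + a * c * B x) μ := iT5.add iT6
  have i78 : Integrable (fun x => b * c * A x - a * b * c) μ := iT7.sub (integrable_const _)
  have iR : Integrable (fun x => (a * b * C x + a * c * B x) + (b * c * A x - a * b * c)) μ := i56.add i78
  have e : ∀ x, (A x - a) * (B x - b) * (C x - c) =
      ((A x * B x * C x - a * (B x * C x)) - (b * (A x * C x) + c * (A x * B x)))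
        + ((a * b * C x + a * c * B x) + (b * c * A x - a * b * c)) := fun x => by ring
  simp_rw [e]
  rw [integral_add iL iR, integral_sub i12 i34, integral_sub iT1 iT2, integral_add iT3 iT4, integral_add i56 i78,
    integral_add iT5 iT6, integral_sub iT7 (integrable_const _), integral_const_mul, integral_const_mul,
    integral_const_mul, integral_const_mul, integral_const_mul, integral_const_mul, integral_const]
  simp only [probReal_univ, smul_eq_mul, one_mul]
  ring

end Centred

section DensMoments

variable {G : Type} [Group G] [TopologicalSpace G] [IsTopologicalGroup G] [CompactSpace G]
  [MeasurableSpace G] [BorelSpace G] (r : LatticeRep G) (μ : Measure (LGConfig 4 G)) [IsProbabilityMeasure μ]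

/-- The action densities are measurable (second countability of `G` from the faithful representation). [folklore] -/
theorem measurable_dens (x : Site 4) : Measurable (dens G r x) := by
  haveI : SecondCountableTopology G :=
    (r.continuous.isClosedEmbedding r.injective).isEmbedding.secondCountableTopology
  exact (continuous_dens r x).measurable

/-- **The covariance of the densities is their second centred mixed moment.** [folklore] -/
theorem stateCov_eq_integral_centred (x y : Site 4) :
    stateCov G r μ x y = ∫ U, (dens G r x U - ∫ V, dens G r x V ∂μ) * (dens G r y U - ∫ V, dens G r y V ∂μ) ∂μ := by
  obtain ⟨C, -, hC⟩ := exists_abs_dens_le_uniform (G := G) r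
  rw [integral_centred_two μ (measurable_dens r x) (measurable_dens r y) (hC x) (hC y)]
  unfold stateCov
  ring

/-- **The third cumulant of the densities is their third centred mixed moment.** [folklore] -/
theorem stateK3_eq_integral_centred (x y z : Site 4) :
    stateK3 G r μ x y z = ∫ U, (dens G r x U - ∫ V, dens G r x V ∂μ) * (dens G r y U - ∫ V, dens G r y V ∂μ) *
      (dens G r z U - ∫ V, dens G r z V ∂μ) ∂μ := by
  obtain ⟨C, -, hC⟩ := exists_abs_dens_le_uniform (G := G) r
  rw [integral_centred_three μ (measurable_dens r x) (measurable_dens r y) (measurable_dens r z) (hC x) (hC y) (hC z)]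
  unfold stateK3
  ring

/-! ## §2 The multilinear expansion: centred density moments are orientation sums of plane-string weights -/

/-- The set of valid plaquette orientations `{(i, j) : i < j}` (local abbreviation). [folklore] -/
theorem dens_centred_eq_sum_plane_centred (x : Site 4) (U : LGConfig 4 G) :
    dens G r x U - ∫ V, dens G r x V ∂μ =
      ∑ q ∈ Finset.univ.filter (fun q : Fin 4 × Fin 4 => q.1 < q.2),
        (plane G r q x U - ∫ V, plane G r q x V ∂μ) := by
  obtain ⟨Cp, hCp⟩ := exists_abs_plane_le (G := G) r
  have hint : ∀ q ∈ Finset.univ.filter (fun q : Fin 4 × Fin 4 => q.1 < q.2), Integrable (plane G r q x) μ :=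
    fun q _ => integrable_of_abs_le (measurable_plane r q x) (hCp q x)
  rw [Finset.sum_sub_distrib, ← integral_finsetSum _ hint, dens_eq_sum_filter_plane r x U]
  congr 1
  exact integral_congr_ae (ae_of_all _ fun V => dens_eq_sum_filter_plane r x V)

/-- **THE DICTIONARY**: for a probability state `μ`, every `n` and sites `x : Fin n → ℤ⁴`,
`∫ ∏ᵢ (A_{xᵢ} − ∫A_{xᵢ} dμ) dμ = Σ_{Q : Fin n → valid orientations} stateMomentStr μ n Q x`. [folklore] -/
theorem integral_prod_dens_centred_eq_sum_stateMomentStr {n : ℕ} (x : Fin n → Site 4) :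
    ∫ U, ∏ i, (dens G r (x i) U - ∫ V, dens G r (x i) V ∂μ) ∂μ =
      ∑ Q ∈ Fintype.piFinset (fun _ : Fin n => Finset.univ.filter (fun q : Fin 4 × Fin 4 => q.1 < q.2)),
        stateMomentStr G r μ n Q x := by
  classical
  obtain ⟨Cp, hCp⟩ := exists_abs_plane_le (G := G) r
  have hexp : ∀ U, ∏ i, (dens G r (x i) U - ∫ V, dens G r (x i) V ∂μ) =
      ∑ Q ∈ Fintype.piFinset (fun _ : Fin n => Finset.univ.filter (fun q : Fin 4 × Fin 4 => q.1 < q.2)),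
        ∏ i, (plane G r (Q i) (x i) U - ∫ V, plane G r (Q i) (x i) V ∂μ) := by
    intro U
    simp_rw [dens_centred_eq_sum_plane_centred r μ]
    rw [Finset.prod_univ_sum]
  simp_rw [hexp]
  rw [integral_finsetSum]
  · rfl
  · intro Q _
    have hmean : ∀ i, |∫ V, plane G r (Q i) (x i) V ∂μ| ≤ Cp := fun i => abs_integral_le_of_abs_le (hCp _ _)
    have h := integrable_finset_prod_of_bounded μ Finset.univ
      (fun i U => plane G r (Q i) (x i) U - ∫ V, plane G r (Q i) (x i) V ∂μ)
      (fun i => (measurable_plane r (Q i) (x i)).sub measurable_const)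
      (fun i => ⟨Cp + Cp, fun U => (abs_sub _ _).trans (add_le_add (hCp _ _ _) (hmean i))⟩)
    simpa using h

/-! ## §3 Covariance and third cumulant as orientation sums -/

/-- **`stateCov` is the orientation sum of the `n = 2` plane-string weights.** [folklore] -/
theorem stateCov_eq_sum_stateMomentStr (x y : Site 4) :
    stateCov G r μ x y =
      ∑ Q ∈ Fintype.piFinset (fun _ : Fin 2 => Finset.univ.filter (fun q : Fin 4 × Fin 4 => q.1 < q.2)),
        stateMomentStr G r μ 2 Q ![x, y] := by
  rw [stateCov_eq_integral_centred r μ x y, ← integral_prod_dens_centred_eq_sum_stateMomentStr r μ ![x, y]]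
  refine integral_congr_ae (ae_of_all _ fun U => ?_)
  simp [Fin.prod_univ_two]

/-- **`stateK3` is the orientation sum of the `n = 3` plane-string weights.** [folklore] -/
theorem stateK3_eq_sum_stateMomentStr (x y z : Site 4) :
    stateK3 G r μ x y z =
      ∑ Q ∈ Fintype.piFinset (fun _ : Fin 3 => Finset.univ.filter (fun q : Fin 4 × Fin 4 => q.1 < q.2)),
        stateMomentStr G r μ 3 Q ![x, y, z] := by
  rw [stateK3_eq_integral_centred r μ x y z, ← integral_prod_dens_centred_eq_sum_stateMomentStr r μ ![x, y, z]]
  refine integral_congr_ae (ae_of_all _ fun U => ?_)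
  simp [Fin.prod_univ_three]

/-! ## §4 `Q2State` / `Q3State` as orientation sums of plane-string series -/

omit [IsTopologicalGroup G] [CompactSpace G] [BorelSpace G] in
/-- The plane-string weights of a probability state are bounded by `(Cₚ + Cₚ)ⁿ` (seat p2's `abs_infVolWeight_le` read
through the name `stateMomentStr`). [folklore] -/
theorem abs_stateMomentStr_le {Cp : ℝ} (hCp : ∀ (q : Fin 4 × Fin 4) (x : Fin 4 → ℤ) (U : LGConfig 4 G), |plane G r q x U| ≤ Cp)
    {n : ℕ} (Q : Fin n → Fin 4 × Fin 4) (x : Fin n → Site 4) : |stateMomentStr G r μ n Q x| ≤ (Cp + Cp) ^ n :=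
  abs_infVolWeight_le r hCp μ Q x

/-- **`Q2State` as an orientation sum of `n = 2` plane-string series with tensor weights** (`s > 0`):
`Q2State μ s f g = Σ_Q Σ'_{(x,y)} f(s x) g(s y) · stateMomentStr μ 2 Q ![x, y]`. [folklore] -/
theorem q2State_eq_sum_series {s : ℝ} (hs : 0 < s) (f g : 𝓢(EuclideanSpace ℝ (Fin 4), ℝ)) :
    Q2State G r μ s f g =
      ∑ Q ∈ Fintype.piFinset (fun _ : Fin 2 => Finset.univ.filter (fun q : Fin 4 × Fin 4 => q.1 < q.2)),
        ∑' p : Site 4 × Site 4, f (s • siteToE p.1) * g (s • siteToE p.2) * stateMomentStr G r μ 2 Q ![p.1, p.2] := by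
  obtain ⟨Cp, hCp⟩ := exists_abs_plane_le (G := G) r
  unfold Q2State
  simp_rw [stateCov_eq_sum_stateMomentStr r μ, Finset.mul_sum]
  refine Summable.tsum_finsetSum fun Q _ => ?_
  refine Summable.of_norm_bounded ((summable_abs_pairWeight f g hs).mul_right ((Cp + Cp) ^ 2)) fun p => ?_
  rw [Real.norm_eq_abs, abs_mul]
  exact mul_le_mul_of_nonneg_left (abs_stateMomentStr_le r μ hCp Q _) (abs_nonneg _)

/-- **`Q3State` as an orientation sum of `n = 3` plane-string series with tensor weights** (`s > 0`). [folklore] -/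
theorem q3State_eq_sum_series {s : ℝ} (hs : 0 < s) (f g h : 𝓢(EuclideanSpace ℝ (Fin 4), ℝ)) :
    Q3State G r μ s f g h =
      ∑ Q ∈ Fintype.piFinset (fun _ : Fin 3 => Finset.univ.filter (fun q : Fin 4 × Fin 4 => q.1 < q.2)),
        ∑' p : Site 4 × Site 4 × Site 4, f (s • siteToE p.1) * g (s • siteToE p.2.1) * h (s • siteToE p.2.2) *
          stateMomentStr G r μ 3 Q ![p.1, p.2.1, p.2.2] := by
  obtain ⟨Cp, hCp⟩ := exists_abs_plane_le (G := G) r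
  unfold Q3State
  simp_rw [stateK3_eq_sum_stateMomentStr r μ, Finset.mul_sum]
  refine Summable.tsum_finsetSum fun Q _ => ?_
  refine Summable.of_norm_bounded ((summable_abs_tripleWeight f g h hs).mul_right ((Cp + Cp) ^ 3)) fun p => ?_
  rw [Real.norm_eq_abs, abs_mul]
  exact mul_le_mul_of_nonneg_left (abs_stateMomentStr_le r μ hCp Q _) (abs_nonneg _)

end DensMoments

end Summit.QuantumFields.YangMills.Theorems.InfiniteVolume

end
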